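import Summits.CriticalPhenomena.PercolationContinuityZ3.Theorems.PercNearOneGluingNoHeavyLowerTailKnQuestion8CoefficientwiseNCAGlue
import Summits.CriticalPhenomena.PercolationContinuityZ3.Theorems.PercNearOneGluingNoHeavyLowerTailKnQuestion8CoefficientwiseNCABase
import HarnessLib

/-!
# NCA along a block sequence (iterated cut-vertex gluing) — prim-lf-2 gen 65

Support file (`--supports stmt-CriticalPhenomena-4575`, closed), prover `prim-lf-2` (gen 65).  No definitions, no named facts, no sorries; standard axioms.
Memo `prim-lf-2/CW-NCDOWN-gen65.md` §4; the one-step theorem is gen 63's `nca_glue` (`…CoefficientwiseNCAGlue.lean`).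

A BLOCK SEQUENCE is a finite sequence of pairwise disjoint edge sets `Eb 0, Eb 1, …, Eb (k−1)` with attachment vertices `u j` such that an edge of `Eb j` meets the
earlier blocks only at `u j`, and the root `x` lies on `Eb j` only if `x = u j` (take `u 0 = x`) (the blocks of a graph listed along its block–cut tree from the root are an
example; so is any tree of NCA-positive pieces).  If every `(Eb j, u j)` is NCA-positive for all avoided / target sets and all monotone pairs, then so is the union
rooted at `x` — induction on `k` with `nca_glue`, starting from the empty edge set (`nca_of_root_on_one_edge`).
* `Coefficientwise.nca_of_blockSequence`.
With `nca_cycle` (gen 65) and `nca_of_root_on_one_edge` (gen 63) as block inputs: CONJECTURE NCA / NC* (hence NO-CORE, `(I1)_X`, `A₀₀`) holds on every CACTUS (every block a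
cycle, a digon or a bridge), for every root and all `(X, W)`; more generally on every graph glued from NCA-positive blocks.
[cite: KozmaNitzan2024, Questions 8–9 (§5.5 p. 36) (context: the Question-8 pocket covariance programme)]
-/

namespace Summit.CriticalPhenomena.PercolationContinuityZ3.Theorems

open Finset Literature.Probability.Percolation

namespace Coefficientwise

variable {ι V : Type*} [DecidableEq ι]

open Classical in
/-- **NCA along a block sequence.**  Let `Eb 0, …, Eb (k−1)` be pairwise disjoint edge sets with attachment vertices `u j` (typically `u 0 = x`), such that for `i < j` an edge of
`Eb i` and an edge of `Eb j` share only the vertex `u j`, and `x` lies on an edge of `Eb j` only if `x = u j`.  If each `(Eb j, u j)` has all its NCA sums nonnegative,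
then for all `X, W` and monotone `f, g` the NCA sum of `(⋃_{j<k} Eb j, x)` is nonnegative.
[cite: KozmaNitzan2024, Questions 8–9 (§5.5 p. 36) (context)] -/
theorem nca_of_blockSequence (ends : ι → Sym2 V) (x : V) (Eb : ℕ → Finset ι) (u : ℕ → V) (k : ℕ)
    (hdisj : ∀ i j, i < j → j < k → Disjoint (Eb i) (Eb j))
    (hsep : ∀ i j, i < j → j < k → ∀ e ∈ Eb i, ∀ e' ∈ Eb j, ∀ w : V, w ∈ ends e → w ∈ ends e' → w = u j)
    (hx : ∀ j, j < k → ∀ e ∈ Eb j, x ∈ ends e → x = u j)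
    (hblock : ∀ j, j < k → ∀ (X' W' : Set V) (φ ψ : Set V → ℝ), Monotone φ → Monotone ψ →
      0 ≤ ∑ s ∈ (Eb j).powerset.filter (fun s : Finset ι =>
            (∀ v ∈ X', v ∉ openCluster (ends '' (↑s : Set ι)) (u j) ∧ v ∉ openCluster (ends '' (↑(Eb j \ s) : Set ι)) (u j)) ∧
            (∀ w ∈ W', ¬ (w ∈ openCluster (ends '' (↑s : Set ι)) (u j) ∧ w ∈ openCluster (ends '' (↑(Eb j \ s) : Set ι)) (u j)))),
        (φ (openCluster (ends '' (↑s : Set ι)) (u j)) - φ (openCluster (ends '' (↑(Eb j \ s) : Set ι)) (u j))) *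
          (ψ (openCluster (ends '' (↑s : Set ι)) (u j)) - ψ (openCluster (ends '' (↑(Eb j \ s) : Set ι)) (u j))))
    (X W : Set V) (f g : Set V → ℝ) (hf : Monotone f) (hg : Monotone g) :
    0 ≤ ∑ s ∈ ((Finset.range k).biUnion Eb).powerset.filter (fun s : Finset ι =>
            (∀ v ∈ X, v ∉ openCluster (ends '' (↑s : Set ι)) x ∧ v ∉ openCluster (ends '' (↑((Finset.range k).biUnion Eb \ s) : Set ι)) x) ∧
            (∀ w ∈ W, ¬ (w ∈ openCluster (ends '' (↑s : Set ι)) x ∧ w ∈ openCluster (ends '' (↑((Finset.range k).biUnion Eb \ s) : Set ι)) x))),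
      (f (openCluster (ends '' (↑s : Set ι)) x) - f (openCluster (ends '' (↑((Finset.range k).biUnion Eb \ s) : Set ι)) x)) *
        (g (openCluster (ends '' (↑s : Set ι)) x) - g (openCluster (ends '' (↑((Finset.range k).biUnion Eb \ s) : Set ι)) x)) := by
  induction k generalizing X W f g with
  | zero =>
    rw [Finset.range_zero, Finset.biUnion_empty]
    exact nca_of_root_on_one_edge ends ∅ x (fun e he => absurd he (Finset.notMem_empty e)) X W f g hf hg
  | succ k ih =>
    have hprev : Finset.range (k + 1) = insert k (Finset.range k) := Finset.range_add_one
    rw [hprev, Finset.biUnion_insert, Finset.union_comm]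
    refine nca_glue ends (E₁ := (Finset.range k).biUnion Eb) (E₂ := Eb k) (x := x) (u := u k) ?_ ?_ ?_ ?_ ?_ X W f g hf hg
    · -- disjointness
      rw [Finset.disjoint_biUnion_left]
      intro i hi
      exact hdisj i k (Finset.mem_range.mp hi) (Nat.lt_succ_self k)
    · -- separation at `u k`
      intro e he e' he' w hw hw'
      obtain ⟨i, hi, hei⟩ := Finset.mem_biUnion.mp he
      exact hsep i k (Finset.mem_range.mp hi) (Nat.lt_succ_self k) e hei e' he' w hw hw'
    · -- the root lies on `Eb k` only at `u k`
      intro e he hxe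
      exact hx k (Nat.lt_succ_self k) e he hxe
    · -- the earlier blocks, by induction
      intro X' W' φ ψ hφ hψ
      exact ih (fun i j hij hjk => hdisj i j hij (Nat.lt_succ_of_lt hjk))
        (fun i j hij hjk => hsep i j hij (Nat.lt_succ_of_lt hjk))
        (fun j hjk => hx j (Nat.lt_succ_of_lt hjk))
        (fun j hjk => hblock j (Nat.lt_succ_of_lt hjk)) X' W' φ ψ hφ hψ
    · -- the new block
      intro X' W' φ ψ hφ hψ
      exact hblock k (Nat.lt_succ_self k) X' W' φ ψ hφ hψ

end Coefficientwise

end Summit.CriticalPhenomena.PercolationContinuityZ3.Theorems
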